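import Literature.RingTheory.MvPolynomial.StandardMonomialCount
import Literature.RingTheory.MvPolynomial.MultigradedHilbertFunction
import Literature.RingTheory.MvPolynomial.LeadingExponents
import HarnessLib

/-!
# The multigraded Hilbert polynomial of a multihomogeneous ideal exists and has non-negative
# top form

Topic: `Literature/RingTheory/MvPolynomial`. Let `S = K[X_0, …, X_{n-1}]` carry the block
multigrading of `blk : Fin n → ι` (`w i = e_{blk i} ∈ ℕ^ι`) and let `I` be an ideal closed under
taking multihomogeneous components. Then:

* `finrank_wpiece_eq_card` — **Macaulay's count, multigraded**:
  `dim_K I_t = #{a ∈ E(I) : mdeg a = t}` for the leading exponents `E(I)` of any monomial order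
  (as the tree's `finrank_idealDegree_eq_card`, one multidegree at a time);
  `finrank_weightedHomogeneousSubmodule_eq_card` — `dim_K S_t = #{a : mdeg a = t}`;
  `hilbert_eq_card_standard` — `H(I; t) = dim S_t - dim I_t = #{a ∉ E(I) : mdeg a = t}`;
* **`exists_hilbertMvPolynomial`** — there are `P_I ∈ ℚ[T_l : l ∈ ι]` and `t₀` with
  `H(I; t) = P_I(t)` for all `t ≥ t₀`, and all coefficients of `P_I` of total degree
  `≥ deg P_I` are `≥ 0` (van der Waerden 1928 for the existence; the non-negativity of the top
  form — the multidegrees — comes here from the orthant decomposition of the standard monomials,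
  `exists_mvPolynomial_card_standard`);
* `hilbert_bot_eq_card`, `hilbert_bot_eq_eval` — for `I = (0)`:
  `H((0); t) = Π_l binom(n_l + t_l - 1, t_l)`, `n_l = |blk⁻¹ l|`, the value of
  `Π_l p_{n_l}(T_l)`.

## References

* B. L. van der Waerden, *On Hilbert's function, series of composition of ideals and a
  generalization of the theorem of Bézout*, Proc. Royal Acad. Amsterdam 31 (1928), 749–770.
* V. Cossart, U. Jannsen, S. Saito, LNM 2270 (2020), proof of Thm. 2.15 (Macaulay's count).
  [CossartJannsenSaito2020]
-/

noncomputable section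

open Finset MvPolynomial Module

namespace Literature.RingTheory.MvPolynomial

variable {K : Type*} [Field K] {ι : Type*} [Fintype ι] [DecidableEq ι] {n : ℕ}
  (mo : MonomialOrder (Fin n))

/-! ## Leading exponents of multihomogeneous components -/

omit [Fintype ι] [DecidableEq ι] in
/-- The leading exponent of a non-zero polynomial of weight `t` has weight `t`. [folklore] -/
theorem weight_degree_of_isWeightedHomogeneous (w : Fin n → ι → ℕ) {f : MvPolynomial (Fin n) K}
    {t : ι → ℕ} (hf : f.IsWeightedHomogeneous w t) (hf0 : f ≠ 0) :
    Finsupp.weight w (mo.degree f) = t :=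
  hf (MvPolynomial.mem_support_iff.mp ((mo.degree_mem_support_iff f).mpr hf0))

omit [Fintype ι] [DecidableEq ι] in
/-- **The weight-`t` component of `f` has the same leading exponent as `f` when that exponent has
weight `t`** (and is then non-zero). [folklore] -/
theorem degree_weightedHomogeneousComponent_eq (w : Fin n → ι → ℕ) {f : MvPolynomial (Fin n) K}
    (hf0 : f ≠ 0) {t : ι → ℕ} (ht : Finsupp.weight w (mo.degree f) = t) :
    weightedHomogeneousComponent w t f ≠ 0 ∧
      mo.degree (weightedHomogeneousComponent w t f) = mo.degree f := by
  classical
  have hcoeff : coeff (mo.degree f) (weightedHomogeneousComponent w t f) ≠ 0 := by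
    rw [coeff_weightedHomogeneousComponent, if_pos ht]
    exact mo.coeff_degree_ne_zero_iff.mpr hf0
  have hne : weightedHomogeneousComponent w t f ≠ 0 := fun h => hcoeff (by rw [h, coeff_zero])
  refine ⟨hne, mo.toSyn.injective (le_antisymm ?_ ?_)⟩
  · refine mo.degree_le_iff.mpr fun c hc => mo.le_degree ?_
    rw [MvPolynomial.mem_support_iff] at hc ⊢
    rw [coeff_weightedHomogeneousComponent] at hc
    split_ifs at hc with h
    · exact hc
    · exact absurd rfl hc
  · exact mo.le_degree (MvPolynomial.mem_support_iff.mpr hcoeff)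

/-! ## Macaulay's count, one multidegree at a time -/

/-- **`dim_K I_t = #{a ∈ E(I) : mdeg a = t}`** for an ideal `I` closed under multihomogeneous
components, `E(I)` the leading exponents for the monomial order `mo`
(cf. `finrank_idealDegree_eq_card`). [cite: CossartJannsenSaito2020, Thm. 2.15 (proof)] -/
theorem finrank_wpiece_eq_card (blk : Fin n → ι) (I : Ideal (MvPolynomial (Fin n) K))
    (hI : ∀ p ∈ I, ∀ m, weightedHomogeneousComponent (fun i => (Pi.single (blk i) 1 : ι → ℕ)) m p ∈ I)
    (t : ι → ℕ) [DecidablePred (· ∈ leadingExponents mo I)] :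
    finrank K ↥(Submodule.restrictScalars K I ⊓
        weightedHomogeneousSubmodule K (fun i => (Pi.single (blk i) 1 : ι → ℕ)) t) =
      (((univ : Finset (Fin n)).finsuppAntidiag (∑ l, t l)).filter (fun a =>
        a ∈ leadingExponents mo I ∧
          Finsupp.weight (fun i => (Pi.single (blk i) 1 : ι → ℕ)) a = t)).card := by
  classical
  have hw : ∀ i, (fun i => (Pi.single (blk i) 1 : ι → ℕ)) i ≠ 0 := fun i h => by
    have := congr_fun h (blk i)
    simp at this
  haveI := finite_weightedHomogeneousSubmodule_of_ne_zero (K := K)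
    (fun i => (Pi.single (blk i) 1 : ι → ℕ)) hw t
  apply le_antisymm
  · refine finrank_le_card_of_degree_mem mo fun v hv hv0 => ?_
    obtain ⟨hvI, hvt⟩ := mem_wpiece.mp hv
    have hwt := weight_degree_of_isWeightedHomogeneous mo _ hvt hv0
    rw [mem_filter, mem_finsuppAntidiag_univ_iff]
    exact ⟨by rw [degree_eq_sum_weight_blockWeight blk, hwt], ⟨v, hvI, hv0, rfl⟩, hwt⟩
  · refine card_le_finrank_of_degree mo fun μ hμ => ?_
    rw [mem_filter] at hμ
    obtain ⟨-, ⟨f, hfI, hf0, rfl⟩, hμt⟩ := hμ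
    obtain ⟨hne, hdeg⟩ := degree_weightedHomogeneousComponent_eq mo _ hf0 hμt
    exact ⟨weightedHomogeneousComponent _ t f, mem_wpiece.mpr
      ⟨hI f hfI t, weightedHomogeneousComponent_isWeightedHomogeneous t f⟩, hne, hdeg⟩

/-- **`dim_K S_t = #{a : mdeg a = t}`** (the monomials of multidegree `t` form a basis of
`S_t`; the case `I = (1)` of the previous count). [folklore] -/
theorem finrank_weightedHomogeneousSubmodule_eq_card (blk : Fin n → ι) (t : ι → ℕ) :
    finrank K (weightedHomogeneousSubmodule K (fun i => (Pi.single (blk i) 1 : ι → ℕ)) t) =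
      (((univ : Finset (Fin n)).finsuppAntidiag (∑ l, t l)).filter (fun a =>
        Finsupp.weight (fun i => (Pi.single (blk i) 1 : ι → ℕ)) a = t)).card := by
  classical
  have h := finrank_wpiece_eq_card (K := K) MonomialOrder.lex blk ⊤ (fun p _ m => Submodule.mem_top) t
  rw [wpiece_top] at h
  rw [h]
  congr 1
  refine filter_congr fun a _ => ?_
  simp only [and_iff_right_iff_imp]
  intro _
  exact ⟨monomial a 1, Submodule.mem_top, monomial_eq_zero.not.mpr one_ne_zero,
    by rw [MonomialOrder.degree_monomial, if_neg one_ne_zero]⟩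

/-- **`H(I; t) = #{a ∉ E(I) : mdeg a = t}`**: the Hilbert function counts the standard
monomials of multidegree `t`. [folklore] -/
theorem hilbert_eq_card_standard (blk : Fin n → ι) (I : Ideal (MvPolynomial (Fin n) K))
    (hI : ∀ p ∈ I, ∀ m, weightedHomogeneousComponent (fun i => (Pi.single (blk i) 1 : ι → ℕ)) m p ∈ I)
    (t : ι → ℕ) [DecidablePred (· ∈ leadingExponents mo I)] :
    finrank K (weightedHomogeneousSubmodule K (fun i => (Pi.single (blk i) 1 : ι → ℕ)) t) -
      finrank K ↥(Submodule.restrictScalars K I ⊓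
        weightedHomogeneousSubmodule K (fun i => (Pi.single (blk i) 1 : ι → ℕ)) t) =
      (((univ : Finset (Fin n)).finsuppAntidiag (∑ l, t l)).filter (fun a =>
        a ∉ leadingExponents mo I ∧
          Finsupp.weight (fun i => (Pi.single (blk i) 1 : ι → ℕ)) a = t)).card := by
  classical
  rw [finrank_weightedHomogeneousSubmodule_eq_card blk t, finrank_wpiece_eq_card mo blk I hI t]
  rw [← Finset.card_filter_add_card_filter_not
    (s := ((univ : Finset (Fin n)).finsuppAntidiag (∑ l, t l)).filter (fun a =>
      Finsupp.weight (fun i => (Pi.single (blk i) 1 : ι → ℕ)) a = t))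
    (fun a => a ∈ leadingExponents mo I)]
  rw [Finset.filter_filter, Finset.filter_filter]
  have h1 : ((univ : Finset (Fin n)).finsuppAntidiag (∑ l, t l)).filter (fun a =>
      Finsupp.weight (fun i => (Pi.single (blk i) 1 : ι → ℕ)) a = t ∧ a ∈ leadingExponents mo I) =
      ((univ : Finset (Fin n)).finsuppAntidiag (∑ l, t l)).filter (fun a =>
        a ∈ leadingExponents mo I ∧ Finsupp.weight (fun i => (Pi.single (blk i) 1 : ι → ℕ)) a = t) :=
    filter_congr fun a _ => and_comm
  have h2 : ((univ : Finset (Fin n)).finsuppAntidiag (∑ l, t l)).filter (fun a =>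
      Finsupp.weight (fun i => (Pi.single (blk i) 1 : ι → ℕ)) a = t ∧ a ∉ leadingExponents mo I) =
      ((univ : Finset (Fin n)).finsuppAntidiag (∑ l, t l)).filter (fun a =>
        a ∉ leadingExponents mo I ∧ Finsupp.weight (fun i => (Pi.single (blk i) 1 : ι → ℕ)) a = t) :=
    filter_congr fun a _ => and_comm
  rw [h1, h2, Nat.add_sub_cancel_left]

/-! ## The multigraded Hilbert polynomial -/

/-- **Existence of the multigraded Hilbert polynomial, with non-negative top form** (van der
Waerden 1928): for an ideal `I` of `K[X_0, …, X_{n-1}]` closed under multihomogeneous components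
of the block grading `blk : Fin n → ι`, there are `P ∈ ℚ[T_l : l ∈ ι]` and `t₀ ∈ ℕ^ι` such that
`H(I; t) = dim_K S_t - dim_K I_t = P(t)` for all `t ≥ t₀` (coordinatewise), and every coefficient
of `P` in total degree `≥ deg P` is `≥ 0`. [folklore] -/
theorem exists_hilbertMvPolynomial (blk : Fin n → ι) (I : Ideal (MvPolynomial (Fin n) K))
    (hI : ∀ p ∈ I, ∀ m, weightedHomogeneousComponent (fun i => (Pi.single (blk i) 1 : ι → ℕ)) m p ∈ I) :
    ∃ (P : MvPolynomial ι ℚ) (t₀ : ι → ℕ),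
      (∀ t : ι → ℕ, t₀ ≤ t →
        ((finrank K (weightedHomogeneousSubmodule K (fun i => (Pi.single (blk i) 1 : ι → ℕ)) t) -
          finrank K ↥(Submodule.restrictScalars K I ⊓
            weightedHomogeneousSubmodule K (fun i => (Pi.single (blk i) 1 : ι → ℕ)) t) : ℕ) : ℚ) =
          MvPolynomial.eval (fun l => (t l : ℚ)) P) ∧
      (∀ α : ι →₀ ℕ, P.totalDegree ≤ α.degree → 0 ≤ P.coeff α) := by
  classical
  obtain ⟨P, t₀, hP, hpos⟩ := exists_mvPolynomial_card_standard blk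
    (leadingExponents MonomialOrder.lex I) (isUpperSet_leadingExponents _ I)
  refine ⟨P, t₀, fun t ht => ?_, hpos⟩
  rw [hilbert_eq_card_standard MonomialOrder.lex blk I hI t]
  convert hP t ht using 4

/-! ## The polynomial ring itself -/

/-- **`H((0); t) = Π_l binom(n_l + t_l - 1, t_l)`**, `n_l = |blk⁻¹ l|`: the number of monomials
of multidegree `t`. [folklore] -/
theorem hilbert_bot_eq_card (blk : Fin n → ι) (t : ι → ℕ) :
    finrank K (weightedHomogeneousSubmodule K (fun i => (Pi.single (blk i) 1 : ι → ℕ)) t) -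
      finrank K ↥(Submodule.restrictScalars K (⊥ : Ideal (MvPolynomial (Fin n) K)) ⊓
        weightedHomogeneousSubmodule K (fun i => (Pi.single (blk i) 1 : ι → ℕ)) t) =
      ∏ l, (((univ : Finset (Fin n)).filter (fun i => blk i = l)).card + t l - 1).choose (t l) := by
  classical
  rw [wpiece_bot, finrank_bot, Nat.sub_zero, finrank_weightedHomogeneousSubmodule_eq_card blk t]
  have h := card_filter_orthant_eq_prod blk (fun _ => 0) (univ : Finset (Fin n)) t
    (fun l => by simp)
  simp only [Finset.sum_const_zero, Nat.sub_zero] at h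
  rw [← h]
  congr 1
  exact filter_congr fun a _ => by simp

/-- **`H((0); t)` is the value at `t` of `Π_l p_{n_l}(T_l)`** with
`p_s = (1/(s-1)!) (T+1)⋯(T+s-1)`, provided every block is non-empty. [folklore] -/
theorem hilbert_bot_eq_eval (blk : Fin n → ι)
    (hblk : ∀ l, 1 ≤ ((univ : Finset (Fin n)).filter (fun i => blk i = l)).card) (t : ι → ℕ) :
    ((finrank K (weightedHomogeneousSubmodule K (fun i => (Pi.single (blk i) 1 : ι → ℕ)) t) -
      finrank K ↥(Submodule.restrictScalars K (⊥ : Ideal (MvPolynomial (Fin n) K)) ⊓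
        weightedHomogeneousSubmodule K (fun i => (Pi.single (blk i) 1 : ι → ℕ)) t) : ℕ) : ℚ) =
      MvPolynomial.eval (fun l => (t l : ℚ)) (∏ l, Polynomial.aeval (X l : MvPolynomial ι ℚ)
        ((Polynomial.C ((((((univ : Finset (Fin n)).filter (fun i => blk i = l)).card - 1).factorial
            : ℕ) : ℚ)⁻¹) *
          (ascPochhammer ℚ (((univ : Finset (Fin n)).filter (fun i => blk i = l)).card - 1)).comp
            (Polynomial.X + 1)).comp (Polynomial.X - Polynomial.C ((0 : ℕ) : ℚ)))) := by
  classical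
  rw [hilbert_bot_eq_card, Nat.cast_prod, eval_prod_aeval_X]
  refine Finset.prod_congr rfl fun l _ => ?_
  rw [Polynomial.eval_comp, Polynomial.eval_sub, Polynomial.eval_X, Polynomial.eval_C,
    Nat.cast_zero, sub_zero, ← choose_eq_eval_binomialPolynomial (hblk l), Nat.add_comm]

end Literature.RingTheory.MvPolynomial

end
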